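import Literature.AlgebraicGeometry.Resolution.BlowupsIntegral
import HarnessLib

/-!
# [OURS · L1 W4.5(b) · EL♮] Strict transforms do not see the difference between `W` and `closure W` off the centre
# (crux `EquisingularLiftNat` = stmt-ResolutionOfSingularities-20038 / child stmt-20148; registered stub
# `stub_elnat_tcDeltaPointResolution`, skeleton v5.1; helper `--supports`, lead res-L1-w45b-lead-2 g1)

NOT a statement of any manuscript; OURS plumbing. The (TC) clause of the registered stub `stub_elnat_tcDeltaPointResolution`
lets the user hand ANY set `W ∋ x` (only `closure W` is asked to be locally principal at `x`) and forms the carrier trace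
`υ⁻¹{x} ∩ closure (υ⁻¹(W ∖ {x}))`, while the suppliers (res-type-097 T-TCONE, res-type-100 T-CARRIER-Δ, res-D-pv-029 T-INST)
naturally work with the CLOSED set `closure W`. This file closes that gap once and for all:

* `closure_preimage_diff_eq_of_image_open` — pure topology: if `f : β → α` maps open subsets of `β ∖ f⁻¹ K` to open subsets
  of `α`, then `closure (f ⁻¹' (W ∖ K)) = closure (f ⁻¹' (closure W ∖ K))` for every `W`.
* `isOpen_image_diff_preimage_support_of_isBlowup` — for a blow-up `υ : F₂ → F₁` along `J`, images under `υ` of open subsets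
  of `υ⁻¹(F₁ ∖ supp J)` are open (the blow-up is an open immersion there, tree `IsBlowup.isOpenImmersion_preimage_compl_ι`).
* `closure_preimage_diff_support_eq_of_isBlowup` — hence `closure (υ⁻¹(W ∖ supp J)) = closure (υ⁻¹(closure W ∖ supp J))`;
* `closure_preimage_diff_singleton_eq_of_isBlowup` — the point-centre case `J = 𝓘_{{x}}`:
  `closure (υ⁻¹(W ∖ {x})) = closure (υ⁻¹(closure W ∖ {x}))` — the literal shape of the (TC) clause.
-/

set_option linter.dupNamespace false -- mandated namespace `Summit.<Summit>.<Problem>` of this single-conjunct summit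

open CategoryTheory AlgebraicGeometry TopologicalSpace Topology
open Literature.AlgebraicGeometry.Resolution

namespace Summit.ResolutionOfSingularities.ResolutionOfSingularities.Cruxes.EquisingularLiftNat.Sections

universe u

/-- Pure topology: if `f` maps open subsets of `β ∖ f ⁻¹' K` to open sets, then the closure of `f ⁻¹' (W ∖ K)` only
depends on `closure W`. [folklore] -/
theorem closure_preimage_diff_eq_of_image_open {α β : Type*} [TopologicalSpace α] [TopologicalSpace β]
    {f : β → α} {K : Set α} (hopen : ∀ V : Set β, IsOpen V → IsOpen (f '' (V \ f ⁻¹' K))) (W : Set α) :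
    closure (f ⁻¹' (W \ K)) = closure (f ⁻¹' (closure W \ K)) := by
  apply le_antisymm
  · exact closure_mono (Set.preimage_mono (Set.sdiff_subset_sdiff_left subset_closure))
  · refine closure_minimal ?_ isClosed_closure
    rintro z ⟨hzW, hzK⟩
    rw [mem_closure_iff]
    intro V hV hzV
    have hfz : f z ∈ f '' (V \ f ⁻¹' K) := ⟨z, ⟨hzV, hzK⟩, rfl⟩
    obtain ⟨w, hwO, hwW⟩ := mem_closure_iff.mp hzW _ (hopen V hV) hfz
    obtain ⟨v, ⟨hvV, hvK⟩, rfl⟩ := hwO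
    exact ⟨v, hvV, hwW, hvK⟩

variable {F₁ F₂ : Scheme.{u}} {υ : F₂ ⟶ F₁} {J : F₁.IdealSheafData}

/-- Off the centre a blow-up is an open immersion, so it maps open subsets of `υ⁻¹(F₁ ∖ supp J)` to open sets. [folklore] -/
theorem isOpen_image_diff_preimage_support_of_isBlowup (hυ : IsBlowup υ J) (V : Set F₂) (hV : IsOpen V) :
    IsOpen ((υ : F₂ → F₁) '' (V \ (υ : F₂ → F₁) ⁻¹' (J.support : Set F₁))) := by
  haveI := hυ.isOpenImmersion_preimage_compl_ι
  set U : F₂.Opens := υ ⁻¹ᵁ centreCompl J with hU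
  set g : (U : Scheme.{u}) ⟶ F₁ := U.ι ≫ υ with hg
  have hemb : IsOpenEmbedding (g : _ → F₁) := g.isOpenEmbedding
  have hV' : IsOpen ((U.ι : _ → F₂) ⁻¹' V) := hV.preimage U.ι.continuous
  have hUset : ((U : F₂.Opens) : Set F₂) = (υ : F₂ → F₁) ⁻¹' ((J.support : Set F₁)ᶜ) := by
    rw [hU]; rfl
  have himg : (g : _ → F₁) '' ((U.ι : _ → F₂) ⁻¹' V) =
      (υ : F₂ → F₁) '' (V \ (υ : F₂ → F₁) ⁻¹' (J.support : Set F₁)) := by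
    ext a
    constructor
    · rintro ⟨y, hy, rfl⟩
      refine ⟨U.ι y, ⟨hy, ?_⟩, ?_⟩
      · have hmem : (U.ι y : F₂) ∈ ((U : F₂.Opens) : Set F₂) := by
          rw [← Scheme.Opens.range_ι]
          exact Set.mem_range_self y
        rw [hUset] at hmem
        exact hmem
      · rw [hg, Scheme.Hom.comp_base, TopCat.coe_comp, Function.comp_apply]
    · rintro ⟨z, ⟨hzV, hzK⟩, rfl⟩
      have hzU : z ∈ ((U : F₂.Opens) : Set F₂) := by
        rw [hUset]
        exact hzK
      rw [← Scheme.Opens.range_ι] at hzU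
      obtain ⟨y, rfl⟩ := hzU
      refine ⟨y, hzV, ?_⟩
      rw [hg, Scheme.Hom.comp_base, TopCat.coe_comp, Function.comp_apply]
  rw [← himg]
  exact hemb.isOpenMap _ hV'

/-- **Strict transforms ignore `W` vs `closure W` off the centre**: for a blow-up `υ` along `J`,
`closure (υ⁻¹(W ∖ supp J)) = closure (υ⁻¹(closure W ∖ supp J))`. [folklore] -/
theorem closure_preimage_diff_support_eq_of_isBlowup (hυ : IsBlowup υ J) (W : Set F₁) :
    closure ((υ : F₂ → F₁) ⁻¹' (W \ (J.support : Set F₁))) =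
      closure ((υ : F₂ → F₁) ⁻¹' (closure W \ (J.support : Set F₁))) :=
  closure_preimage_diff_eq_of_image_open (isOpen_image_diff_preimage_support_of_isBlowup hυ) W

/-- The point-centre case, in the literal shape of the (TC) clause of `stub_elnat_tcDeltaPointResolution`:
`closure (υ⁻¹(W ∖ {x})) = closure (υ⁻¹(closure W ∖ {x}))` for a blow-up `υ` of the reduced closed point `x`. [folklore] -/
theorem closure_preimage_diff_singleton_eq_of_isBlowup {x : F₁} (hx : IsClosed ({x} : Set F₁))
    (hυ : IsBlowup υ (Scheme.IdealSheafData.vanishingIdeal (⟨{x}, hx⟩ : Closeds F₁))) (W : Set F₁) :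
    closure ((υ : F₂ → F₁) ⁻¹' (W \ {x})) = closure ((υ : F₂ → F₁) ⁻¹' (closure W \ {x})) := by
  have h := closure_preimage_diff_support_eq_of_isBlowup hυ W
  rw [Scheme.IdealSheafData.coe_support_vanishingIdeal] at h
  exact h

/-- Consequently the CARRIER TRACE of the (TC) clause is unchanged when `W` is replaced by its closure:
`υ⁻¹{x} ∩ closure (υ⁻¹(W ∖ {x})) = υ⁻¹{x} ∩ closure (υ⁻¹(closure W ∖ {x}))`. [folklore] -/
theorem carrierTrace_eq_of_closure {x : F₁} (hx : IsClosed ({x} : Set F₁))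
    (hυ : IsBlowup υ (Scheme.IdealSheafData.vanishingIdeal (⟨{x}, hx⟩ : Closeds F₁))) (W : Set F₁) :
    (υ : F₂ → F₁) ⁻¹' {x} ∩ closure ((υ : F₂ → F₁) ⁻¹' (W \ {x})) =
      (υ : F₂ → F₁) ⁻¹' {x} ∩ closure ((υ : F₂ → F₁) ⁻¹' (closure W \ {x})) := by
  rw [closure_preimage_diff_singleton_eq_of_isBlowup hx hυ W]

end Summit.ResolutionOfSingularities.ResolutionOfSingularities.Cruxes.EquisingularLiftNat.Sections
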